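import Literature.IUT.HodgeTheaters.GlobalFrobenioidsInfKappa
import Literature.AlgebraicGeometry.Frobenioids.ModelFrobenioidMap
import Literature.AlgebraicGeometry.Frobenioids.RealificationDataCanonical
import HarnessLib

/-!
# [IUTchI] Example 5.1 (vii) p. 130 — THE realification of a model Frobenioid (instance of the data stub
# `FrobenioidRealification`)

Mochizuki, *Inter-universal Teichmüller theory I*, Example 5.1 (vii), kurims p. 130: the realified global
Frobenioids `†ℱ^⊛ℝ_j`, `†ℱ^⊛ℝ_⟨J⟩`, `†ℱ^⊛ℝ_J` are the realifications ([FrdI] Prop. 5.3) of the copies of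
`†ℱ^⊛_mod` [claim: Mochizuki2012, status: disputed]; Mochizuki, *The geometry of Frobenioids I*, Prop. 5.3
p. 103: "Suppose that `Φ` is perf-factorial. Then we shall refer to as the realification `C^rlf` of the
Frobenioid `C` the model Frobenioid [cf. Theorem 5.2, (ii)] associated to the divisor monoid `Φ^rlf` [i.e.,
the 'realification' of Definition 2.4, (i)] and the rational function monoid `ℝ · Φ^birat ⊆ (Φ^rlf)^gp`"
[cite: MochizukiFrdI2008, Prop. 5.3 p.103]; for a model Frobenioid of data `(Φ, Ψ)` the role of `Φ^birat` is
played by `Ψ` (the tree's `RealificationData.RlfModelOf Ψ`, seat abc-iut-L1-t5).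

`GlobalFrobenioidsInfKappa.lean` (seat abc-iut-L5-t1) records a realification as DATA
(`FrobenioidRealification C`: a category `C^ℝ` with a functor `C → C^ℝ`, "TODO-merge:abc-iut-L1-t2").  With
THE realification data `RealificationData.canonical Φ hΦ` (`RealificationDataCanonical.lean`) the stub is
INSTANTIATED for every model Frobenioid `Ψ.ModelOf` (`Ψ ⊆ Φ^gp` a subfunctor of groups, `Φ` with
perf-factorial values): `C^ℝ :=` the model Frobenioid of `(Φ^rlf, ℝ · Ψ)` (`RealificationData.RlfModelOf`) and
`C → C^ℝ :=` the functor along `(Φ, Ψ) → (Φ^rlf, ℝ · Ψ)` (`RealificationData.toRlfModel`,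
`ModelFrobenioidMap.lean`, seat abc-iut-L1-t5).  No statement is re-typed.
Seat abc-iut-L1-d2 (cell abc-iut), row «FrdI:Def2.4(ii)-ℝ-action + I3-MERGE» (L1-lead R45 (4)).
-/

noncomputable section

namespace Literature.IUT.HodgeTheaters

open CategoryTheory Opposite Literature.AlgebraicGeometry.Frobenioids

universe w v u

variable {D : Type u} [Category.{v} D] (Φ : Dᵒᵖ ⥤ CommMonCat.{w})
  (hΦ : ∀ X : Dᵒᵖ, IsPerfFactorial (Φ.obj X)) (Ψ : GpSubfunctor Φ)

/-- **THE realification of the model Frobenioid of `(Φ, Ψ)`** (`Φ` with perf-factorial values): the model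
Frobenioid of `(Φ^rlf, ℝ · Ψ)` for THE realification data, with the natural functor along
`(Φ, Ψ) → (Φ^rlf, ℝ · Ψ)` — an instance of the data stub `FrobenioidRealification` ([FrdI] Prop. 5.3;
[IUTchI] Ex. 5.1 (vii) "the realification").
[cite: MochizukiFrdI2008, Prop. 5.3 p.103] [claim: Mochizuki2012, status: disputed] -/
def FrobenioidRealification.ofModel : FrobenioidRealification Ψ.ModelOf where
  cat := (RealificationData.canonical Φ hΦ).RlfModelOf Ψ
  realify := (RealificationData.canonical Φ hΦ).toRlfModel Ψ

/-- The realified category of `FrobenioidRealification.ofModel` is the model Frobenioid of `(Φ^rlf, ℝ · Ψ)`.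
[cite: MochizukiFrdI2008, Prop. 5.3 p.103] -/
@[simp] theorem FrobenioidRealification.ofModel_cat :
    (FrobenioidRealification.ofModel Φ hΦ Ψ).cat = (RealificationData.canonical Φ hΦ).RlfModelOf Ψ := rfl

/-- The realification functor of `FrobenioidRealification.ofModel` is `RealificationData.toRlfModel`.
[cite: MochizukiFrdI2008, Prop. 5.3 p.103] -/
theorem FrobenioidRealification.ofModel_realify :
    (FrobenioidRealification.ofModel Φ hΦ Ψ).realify = (RealificationData.canonical Φ hΦ).toRlfModel Ψ := rfl

/-- On base objects the realification functor is the identity (`(A_D, α) ↦ (A_D, ι^gp(α))`).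
[cite: MochizukiFrdI2008, Prop. 5.3 p.103] -/
theorem FrobenioidRealification.ofModel_realify_obj_base (A : Ψ.ModelOf) :
    ((FrobenioidRealification.ofModel Φ hΦ Ψ).realify.obj A).base = A.base := rfl

end Literature.IUT.HodgeTheaters
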